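import Summits.QuantumFields.YangMills.Theorems.EguchiKawaiDirectionLadderWordSecondVariation
import HarnessLib

/-!
# The splitting formula: the Laplacian of an arbitrary Eguchi–Kawai word on `SU(N)^d`

HONEST FRAMING. Glue for LINE 8 (`route-QuantumFields-EguchiKawaiDirectionLadder`, barrier-ledger line
onto `Literature.Barriers.QuantumFields.EguchiKawaiBreakdown`), lane «loop equations of the single-site
model» (Makeenko 2023 §14.3, Problem 14.2, (14.50)–(14.51)): the LEFT-HAND (kinetic / splitting) side of
the loop equation for a GENERAL reduced contour `W_l = U_{μ₁}^{ε₁} ⋯ U_{μ_k}^{ε_k}`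
(`l : List (Fin d × Bool)`, w2's `ekWordMat`).

For a link `e` and the Parseval frame `(Y_α)` of `𝔰𝔲(N)`, the link-`e` Laplacian
`Σ_α D_{(e,α)}² Re tr(B W_l)` is computed by the `𝔰𝔲(N)` Casimir identities
`Σ_α Y_α² = -(N - 1/N)·1` and `Σ_α Y_α X Y_α = -(tr X)·1 + X/N`:

* every letter of `l` on the link `e` contributes the Casimir term `-(N - 1/N) tr(B W_l)`;
* every ORDERED PAIR of letters of `l` on the link `e` contributes a SPLITTING term — the product of
  the traces of the two complementary sub-words into which the pair cuts the cyclic word (with signs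
  given by the orientations `ε`), plus a `1/N`-correction — on a single site these sub-words are again
  reduced contours, OPEN (non-zero winding) or closed: this is exactly how the open Wilson lines of
  (14.51) enter the Eguchi–Kawai loop equation (14.50).

The bookkeeping is organised as two recursions along the list: `ekSplitSum e g l P M`
(`= Σ_α tr(Y_α P W₁^{(e,α)}(l) M)`, one `Y` outside and one inside the first jet; `P` accumulates the
letters between the two insertion points, `M` the complement) and `ekLapSum e g l B`
(`= Σ_α tr(B W₂^{(e,α)}(l))`). Main results: `sum_trace_frame_ekWordJet1` and `sum_trace_ekWordJet2`
(the recursions are the frame sums), `lap_reTr_ekWordMat`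
(`Δ Re tr W_l (g) = Σ_e Re ekLapSum e g l 1`), and the clean special case `lap_reTr_ekWordMat_of_nodup`:
a word whose links are pairwise distinct has NO splitting terms and is an eigenfunction,
`Δ Re tr W_l = -(N - 1/N)·|l|·Re tr W_l`.

Nothing here concerns the Yang–Mills mass gap / the summit Statement `YangMills`.

References: Y. Makeenko, *Methods of Contemporary Gauge Theory* (2023) §12.4 (loop equations),
§14.3 Problem 14.2; Yu. Makeenko, A. Migdal, Phys. Lett. B 88 (1979) 135; S. Chatterjee, CMP 366
(2019) 203, Theorem 8.1 (splitting terms of the finite-`N` master loop equation).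
-/

noncomputable section

open scoped Matrix ComplexConjugate BigOperators Matrix.Norms.Frobenius ContDiff Topology
open Matrix Complex Finset MeasureTheory Filter
open Summit.Ventures.YMGap.LatticeBakryEmery
open Summit.Ventures.YMGap
open Literature.MathematicalPhysics.QuantumFieldTheory.SUNBakryEmery (frame FrameIdx frame_conjTranspose)
open Literature.Barriers.QuantumFields (EKConfigSU ekHaarSU inclSU)

namespace Summit.QuantumFields.YangMills.Theorems.EguchiKawaiDirectionLadder

variable {d N : ℕ}

/-! ## The two recursions -/

/-- **The splitting recursion** `ekSplitSum e g l P M = Σ_α tr(Y_α P W₁^{(e,α)}(l) M)`: walking along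
`l`, each letter `(e, +)` (resp. `(e, -)`) met with accumulated middle word `P` contributes the split
product `-tr(P g_e) tr(W_rest M)` (resp. `tr(P) tr(g_eᴴ W_rest M)`) and the `1/N`-correction, and
every letter is then appended to `P`. -/
def ekSplitSum (e : Fin d) (g : PSU (Fin d) N) :
    List (Fin d × Bool) → Matrix (Fin N) (Fin N) ℂ → Matrix (Fin N) (Fin N) ℂ → ℂ
  | [], _, _ => 0
  | a :: l, P, M =>
      (if a.1 = e then
          (if a.2 then
              -((P * (g a.1 : Matrix (Fin N) (Fin N) ℂ)).trace * (ekWordMat l (emb g) * M).trace)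
                + (1 / (N : ℂ)) * (P * (g a.1 : Matrix (Fin N) (Fin N) ℂ) * ekWordMat l (emb g) * M).trace
            else
              P.trace * ((g a.1 : Matrix (Fin N) (Fin N) ℂ)ᴴ * ekWordMat l (emb g) * M).trace
                - (1 / (N : ℂ)) * (P * (g a.1 : Matrix (Fin N) (Fin N) ℂ)ᴴ * ekWordMat l (emb g) * M).trace)
        else 0)
        + ekSplitSum e g l (P * ekLetterMat (emb g) a) M

/-- **The Laplacian recursion** `ekLapSum e g l B = Σ_α tr(B W₂^{(e,α)}(l))`: each letter on the link
`e` contributes the Casimir term `-(N - 1/N) tr(B · letter · W_rest)` and twice the splitting sum of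
the remaining word (with the letter moved into the outer factor), and every letter is appended to `B`. -/
def ekLapSum (e : Fin d) (g : PSU (Fin d) N) :
    List (Fin d × Bool) → Matrix (Fin N) (Fin N) ℂ → ℂ
  | [], _ => 0
  | a :: l, B =>
      (if a.1 = e then
          -(((N : ℂ) - 1 / N) * (B * ekLetterMat (emb g) a * ekWordMat l (emb g)).trace)
            + 2 * (if a.2 then ekSplitSum e g l 1 (B * (g a.1 : Matrix (Fin N) (Fin N) ℂ))
                   else -ekSplitSum e g l ((g a.1 : Matrix (Fin N) (Fin N) ℂ)ᴴ) B)
        else 0)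
        + ekLapSum e g l (B * ekLetterMat (emb g) a)

/-- The splitting sum of the empty word vanishes. -/
@[simp] theorem ekSplitSum_nil (e : Fin d) (g : PSU (Fin d) N) (P M : Matrix (Fin N) (Fin N) ℂ) :
    ekSplitSum e g [] P M = 0 := rfl

/-- Unfolding the splitting recursion. -/
theorem ekSplitSum_cons (e : Fin d) (g : PSU (Fin d) N) (a : Fin d × Bool) (l : List (Fin d × Bool))
    (P M : Matrix (Fin N) (Fin N) ℂ) :
    ekSplitSum e g (a :: l) P M =
      (if a.1 = e then
          (if a.2 then
              -((P * (g a.1 : Matrix (Fin N) (Fin N) ℂ)).trace * (ekWordMat l (emb g) * M).trace)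
                + (1 / (N : ℂ)) * (P * (g a.1 : Matrix (Fin N) (Fin N) ℂ) * ekWordMat l (emb g) * M).trace
            else
              P.trace * ((g a.1 : Matrix (Fin N) (Fin N) ℂ)ᴴ * ekWordMat l (emb g) * M).trace
                - (1 / (N : ℂ)) * (P * (g a.1 : Matrix (Fin N) (Fin N) ℂ)ᴴ * ekWordMat l (emb g) * M).trace)
        else 0)
        + ekSplitSum e g l (P * ekLetterMat (emb g) a) M := rfl

/-- The Laplacian sum of the empty word vanishes. -/
@[simp] theorem ekLapSum_nil (e : Fin d) (g : PSU (Fin d) N) (B : Matrix (Fin N) (Fin N) ℂ) :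
    ekLapSum e g [] B = 0 := rfl

/-- Unfolding the Laplacian recursion. -/
theorem ekLapSum_cons (e : Fin d) (g : PSU (Fin d) N) (a : Fin d × Bool) (l : List (Fin d × Bool))
    (B : Matrix (Fin N) (Fin N) ℂ) :
    ekLapSum e g (a :: l) B =
      (if a.1 = e then
          -(((N : ℂ) - 1 / N) * (B * ekLetterMat (emb g) a * ekWordMat l (emb g)).trace)
            + 2 * (if a.2 then ekSplitSum e g l 1 (B * (g a.1 : Matrix (Fin N) (Fin N) ℂ))
                   else -ekSplitSum e g l ((g a.1 : Matrix (Fin N) (Fin N) ℂ)ᴴ) B)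
        else 0)
        + ekLapSum e g l (B * ekLetterMat (emb g) a) := rfl

/-! ## The jets in a block-frame direction at `s = 0` -/

/-- The first jet of a letter in the direction `Y_{(e,α)}`: `g_e Y_α` / `-Y_α g_eᴴ` on the link `e`,
`0` on the other links. -/
theorem ekLetterJet_one_bframe (g : PSU (Fin d) N) (e : Fin d) (α : FrameIdx N) (a : Fin d × Bool) :
    ekLetterJet g (bframe (e, α)) 1 a 0 =
      if a.1 = e then
        (if a.2 then (g a.1 : Matrix (Fin N) (Fin N) ℂ) * frame α else -frame α * (g a.1 : Matrix (Fin N) (Fin N) ℂ)ᴴ)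
      else 0 := by
  rw [ekLetterJet_one_zero, bframe_apply]
  by_cases h : a.1 = e
  · simp [h]
  · simp [h]

/-- The second jet of a letter in the direction `Y_{(e,α)}`: `g_e Y_α²` / `Y_α² g_eᴴ` on the link `e`,
`0` on the other links. -/
theorem ekLetterJet_two_bframe (g : PSU (Fin d) N) (e : Fin d) (α : FrameIdx N) (a : Fin d × Bool) :
    ekLetterJet g (bframe (e, α)) 2 a 0 =
      if a.1 = e then
        (if a.2 then (g a.1 : Matrix (Fin N) (Fin N) ℂ) * (frame α * frame α)
          else frame α * frame α * (g a.1 : Matrix (Fin N) (Fin N) ℂ)ᴴ)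
      else 0 := by
  rw [ekLetterJet_two_zero, bframe_apply]
  by_cases h : a.1 = e
  · simp [h]
  · simp [h]

/-- The included letter: `ekLetterMat (emb g) (μ, ±)` is `g_μ` / `g_μᴴ`. -/
theorem ekLetterMat_emb_eq (g : PSU (Fin d) N) (a : Fin d × Bool) :
    ekLetterMat (emb g) a =
      if a.2 then (g a.1 : Matrix (Fin N) (Fin N) ℂ) else (g a.1 : Matrix (Fin N) (Fin N) ℂ)ᴴ := by
  unfold ekLetterMat; rfl

/-! ## The frame sums are the recursions -/

/-- **`Σ_α tr(Y_α P W₁^{(e,α)}(l) M) = ekSplitSum e g l P M`** (splitting identity along the word). -/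
theorem sum_trace_frame_ekWordJet1 (hN : N ≠ 0) (e : Fin d) (g : PSU (Fin d) N) (l : List (Fin d × Bool))
    (P M : Matrix (Fin N) (Fin N) ℂ) :
    ∑ α : FrameIdx N, (frame α * P * ekWordJet1 g (bframe (e, α)) l 0 * M).trace = ekSplitSum e g l P M := by
  induction l generalizing P M with
  | nil => simp
  | cons a l ih =>
    simp only [ekWordJet1_cons, ekSplitSum_cons, ekWordJet0_zero, ekLetterJet_zero_zero, ekLetterJet_one_bframe]
    -- split the frame sum into the first-letter term and the recursive term
    have hsplit : ∀ α : FrameIdx N,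
        (frame α * P * ((if a.1 = e then
            (if a.2 then (g a.1 : Matrix (Fin N) (Fin N) ℂ) * frame α
              else -frame α * (g a.1 : Matrix (Fin N) (Fin N) ℂ)ᴴ) else 0) * ekWordMat l (emb g)
            + ekLetterMat (emb g) a * ekWordJet1 g (bframe (e, α)) l 0) * M).trace =
          (frame α * P * (if a.1 = e then
            (if a.2 then (g a.1 : Matrix (Fin N) (Fin N) ℂ) * frame α
              else -frame α * (g a.1 : Matrix (Fin N) (Fin N) ℂ)ᴴ) else 0) * ekWordMat l (emb g) * M).trace
          + (frame α * (P * ekLetterMat (emb g) a) * ekWordJet1 g (bframe (e, α)) l 0 * M).trace := by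
      intro α
      rw [← Matrix.trace_add]
      congr 1
      simp only [Matrix.mul_add, Matrix.add_mul, Matrix.mul_assoc]
    simp_rw [hsplit]
    rw [Finset.sum_add_distrib, ih (P * ekLetterMat (emb g) a) M]
    congr 1
    by_cases he : a.1 = e
    · simp only [he, if_true]
      by_cases h2 : a.2 = true
      · simp only [h2, if_true]
        have key := sum_trace_frame_split hN (1 : Matrix (Fin N) (Fin N) ℂ) (P * (g e : Matrix (Fin N) (Fin N) ℂ))
          (ekWordMat l (emb g) * M)
        have e1 : ∀ α : FrameIdx N, (frame α * P * ((g e : Matrix (Fin N) (Fin N) ℂ) * frame α) *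
            ekWordMat l (emb g) * M).trace = (1 * frame α * (P * (g e : Matrix (Fin N) (Fin N) ℂ)) * frame α *
              (ekWordMat l (emb g) * M)).trace := by
          intro α; simp only [Matrix.one_mul, Matrix.mul_assoc]
        rw [Finset.sum_congr rfl fun α _ => e1 α, key]
        simp only [Matrix.one_mul, Matrix.mul_assoc]
      · simp only [h2, if_false, Bool.false_eq_true]
        have key := sum_trace_frame_split hN (1 : Matrix (Fin N) (Fin N) ℂ) P
          ((g e : Matrix (Fin N) (Fin N) ℂ)ᴴ * ekWordMat l (emb g) * M)
        have e1 : ∀ α : FrameIdx N, (frame α * P * (-frame α * (g e : Matrix (Fin N) (Fin N) ℂ)ᴴ) *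
            ekWordMat l (emb g) * M).trace =
              -(1 * frame α * P * frame α * ((g e : Matrix (Fin N) (Fin N) ℂ)ᴴ * ekWordMat l (emb g) * M)).trace := by
          intro α
          rw [← Matrix.trace_neg]
          congr 1
          simp only [Matrix.one_mul, Matrix.neg_mul, Matrix.mul_neg, Matrix.mul_assoc]
        rw [Finset.sum_congr rfl fun α _ => e1 α, Finset.sum_neg_distrib, key]
        simp only [Matrix.one_mul, Matrix.mul_assoc]
        ring
    · simp only [he, if_false, Matrix.mul_zero, Matrix.zero_mul, Matrix.trace_zero, Finset.sum_const_zero]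

/-- **`Σ_α tr(B W₂^{(e,α)}(l)) = ekLapSum e g l B`** (Casimir + splitting along the word). -/
theorem sum_trace_ekWordJet2 (hN : N ≠ 0) (e : Fin d) (g : PSU (Fin d) N) (l : List (Fin d × Bool))
    (B : Matrix (Fin N) (Fin N) ℂ) :
    ∑ α : FrameIdx N, (B * ekWordJet2 g (bframe (e, α)) l 0).trace = ekLapSum e g l B := by
  induction l generalizing B with
  | nil => simp
  | cons a l ih =>
    simp only [ekWordJet2_cons, ekLapSum_cons, ekWordJet0_zero, ekLetterJet_zero_zero, ekLetterJet_one_bframe,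
      ekLetterJet_two_bframe, Matrix.mul_add, Matrix.trace_add, Finset.sum_add_distrib]
    -- the recursive term
    have hrec : ∀ α : FrameIdx N, (B * (ekLetterMat (emb g) a * ekWordJet2 g (bframe (e, α)) l 0)).trace =
        (B * ekLetterMat (emb g) a * ekWordJet2 g (bframe (e, α)) l 0).trace := by
      intro α; rw [Matrix.mul_assoc]
    simp_rw [hrec]
    rw [ih (B * ekLetterMat (emb g) a)]
    -- the first-jet term, twice, is the splitting sum
    have hJ1 : ∑ α : FrameIdx N, (B * ((if a.1 = e then
        (if a.2 then (g a.1 : Matrix (Fin N) (Fin N) ℂ) * frame α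
          else -frame α * (g a.1 : Matrix (Fin N) (Fin N) ℂ)ᴴ) else 0) * ekWordJet1 g (bframe (e, α)) l 0)).trace =
        if a.1 = e then (if a.2 then ekSplitSum e g l 1 (B * (g a.1 : Matrix (Fin N) (Fin N) ℂ))
          else -ekSplitSum e g l ((g a.1 : Matrix (Fin N) (Fin N) ℂ)ᴴ) B) else 0 := by
      by_cases he : a.1 = e
      · simp only [he, if_true]
        by_cases h2 : a.2 = true
        · simp only [h2, if_true]
          rw [← sum_trace_frame_ekWordJet1 hN e g l 1 (B * (g e : Matrix (Fin N) (Fin N) ℂ))]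
          refine Finset.sum_congr rfl fun α _ => ?_
          -- `tr(B (g Y W₁)) = tr(Y W₁ (B g))`
          rw [Matrix.mul_one, show B * ((g e : Matrix (Fin N) (Fin N) ℂ) * frame α * ekWordJet1 g (bframe (e, α)) l 0) =
              (B * (g e : Matrix (Fin N) (Fin N) ℂ)) * (frame α * ekWordJet1 g (bframe (e, α)) l 0) by
                simp only [Matrix.mul_assoc],
            Matrix.trace_mul_comm, Matrix.mul_assoc]
        · simp only [h2, if_false, Bool.false_eq_true]
          rw [← sum_trace_frame_ekWordJet1 hN e g l ((g e : Matrix (Fin N) (Fin N) ℂ)ᴴ) B, ← Finset.sum_neg_distrib]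
          refine Finset.sum_congr rfl fun α _ => ?_
          -- `tr(B (-Y gᴴ W₁)) = -tr(Y gᴴ W₁ B)`
          rw [show B * (-frame α * (g e : Matrix (Fin N) (Fin N) ℂ)ᴴ * ekWordJet1 g (bframe (e, α)) l 0) =
              -(B * (frame α * (g e : Matrix (Fin N) (Fin N) ℂ)ᴴ * ekWordJet1 g (bframe (e, α)) l 0)) by
                simp only [Matrix.neg_mul, Matrix.mul_neg],
            Matrix.trace_neg, Matrix.trace_mul_comm]
      · simp only [he, if_false, Matrix.zero_mul, Matrix.mul_zero, Matrix.trace_zero, Finset.sum_const_zero]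
    -- the second-jet term is the Casimir term
    have hJ2 : ∑ α : FrameIdx N, (B * ((if a.1 = e then
        (if a.2 then (g a.1 : Matrix (Fin N) (Fin N) ℂ) * (frame α * frame α)
          else frame α * frame α * (g a.1 : Matrix (Fin N) (Fin N) ℂ)ᴴ) else 0) * ekWordMat l (emb g))).trace =
        if a.1 = e then -(((N : ℂ) - 1 / N) * (B * ekLetterMat (emb g) a * ekWordMat l (emb g)).trace) else 0 := by
      by_cases he : a.1 = e
      · simp only [he, if_true, ekLetterMat_emb_eq]
        by_cases h2 : a.2 = true
        · simp only [h2, if_true]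
          have e1 : ∀ α : FrameIdx N, B * ((g e : Matrix (Fin N) (Fin N) ℂ) * (frame α * frame α) * ekWordMat l (emb g)) =
              B * (g e : Matrix (Fin N) (Fin N) ℂ) * frame α * frame α * ekWordMat l (emb g) := by
            intro α; simp only [Matrix.mul_assoc]
          simp_rw [e1]
          rw [sum_trace_frame_sq hN]
        · simp only [h2, if_false, Bool.false_eq_true]
          have e1 : ∀ α : FrameIdx N, B * (frame α * frame α * (g e : Matrix (Fin N) (Fin N) ℂ)ᴴ * ekWordMat l (emb g)) =
              B * frame α * frame α * ((g e : Matrix (Fin N) (Fin N) ℂ)ᴴ * ekWordMat l (emb g)) := by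
            intro α; simp only [Matrix.mul_assoc]
          simp_rw [e1]
          rw [sum_trace_frame_sq hN]
          simp only [Matrix.mul_assoc]
      · simp only [he, if_false, Matrix.zero_mul, Matrix.mul_zero, Matrix.trace_zero, Finset.sum_const_zero]
    rw [hJ1, hJ2]
    by_cases he : a.1 = e
    · simp only [he, if_true]
      ring
    · simp only [he, if_false]
      ring

/-! ## The Laplacian of a word -/

/-- **The Laplacian of an arbitrary word on `SU(N)^d`**: `Δ Re tr W_l (g) = Σ_e Re (ekLapSum e g l 1)` —
the sum over links of the Casimir terms of the letters on that link and of the splitting terms of the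
pairs of letters on that link. -/
theorem lap_reTr_ekWordMat (hN : N ≠ 0) (g : PSU (Fin d) N) (l : List (Fin d × Bool)) :
    Lap (fun Q : Cfg (Fin d) N => (ekWordMat l Q).trace.re) (emb g) = ∑ e : Fin d, (ekLapSum e g l 1).re := by
  unfold Lap
  rw [Fintype.sum_prod_type]
  refine Finset.sum_congr rfl fun e _ => ?_
  have h : ∀ α : FrameIdx N, algD (bframe (e, α)) (algD (bframe (e, α))
      (fun Q : Cfg (Fin d) N => (ekWordMat l Q).trace.re)) (emb g) =
        ((1 : Matrix (Fin N) (Fin N) ℂ) * ekWordJet2 g (bframe (e, α)) l 0).trace.re := by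
    intro α
    rw [algD_algD_reTr_ekWordMat g (bframe (e, α)) (bframe_conjTranspose (e, α)) l, Matrix.one_mul]
  simp_rw [h]
  rw [← Complex.re_sum, sum_trace_ekWordJet2 hN e g l 1]


/-! ## Words without repeated links are eigenfunctions -/

/-- No letter on the link `e` ⇒ no splitting terms. -/
theorem ekSplitSum_eq_zero_of_not_mem (e : Fin d) (g : PSU (Fin d) N) {l : List (Fin d × Bool)}
    (h : e ∉ l.map Prod.fst) (P M : Matrix (Fin N) (Fin N) ℂ) : ekSplitSum e g l P M = 0 := by
  induction l generalizing P with
  | nil => rfl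
  | cons a l ih =>
    rw [List.map_cons, List.mem_cons, not_or] at h
    rw [ekSplitSum_cons, if_neg (fun h' => h.1 h'.symm), zero_add, ih h.2]

/-- For a word whose links are pairwise distinct, the link-`e` Laplacian sum is the single Casimir term
`-(N - 1/N) tr(B W_l)` if `e` occurs in `l`, and `0` otherwise. -/
theorem ekLapSum_of_nodup (e : Fin d) (g : PSU (Fin d) N) {l : List (Fin d × Bool)}
    (hl : (l.map Prod.fst).Nodup) (B : Matrix (Fin N) (Fin N) ℂ) :
    ekLapSum e g l B =
      if e ∈ l.map Prod.fst then -(((N : ℂ) - 1 / N) * (B * ekWordMat l (emb g)).trace) else 0 := by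
  induction l generalizing B with
  | nil => simp
  | cons a l ih =>
    rw [List.map_cons, List.nodup_cons] at hl
    rw [ekLapSum_cons, ih hl.2, List.map_cons, ekWordMat_cons]
    by_cases he : a.1 = e
    · -- `e` is the link of the head letter, hence absent from the tail
      have hnot : e ∉ l.map Prod.fst := fun h' => hl.1 (he ▸ h')
      have hmem : e ∈ a.1 :: l.map Prod.fst := List.mem_cons.2 (Or.inl he.symm)
      rw [if_pos he, if_neg hnot, if_pos hmem, ekSplitSum_eq_zero_of_not_mem e g hnot,
        ekSplitSum_eq_zero_of_not_mem e g hnot]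
      simp only [mul_zero, neg_zero, ite_self, add_zero, Matrix.mul_assoc]
    · rw [if_neg he, zero_add]
      by_cases hm : e ∈ l.map Prod.fst
      · rw [if_pos hm, if_pos (List.mem_cons.2 (Or.inr hm)), Matrix.mul_assoc]
      · have hnot : e ∉ a.1 :: l.map Prod.fst :=
          fun h' => (List.mem_cons.1 h').elim (fun h1 => he h1.symm) hm
        rw [if_neg hm, if_neg hnot]

/-- **A word with pairwise distinct links is an eigenfunction of the Laplacian**:
`Δ Re tr W_l = -(N - 1/N) · |l| · Re tr W_l` on `SU(N)^d` — no splitting, hence no open-line terms in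
its loop equation (e.g. the open line `tr U_μ` itself, or `tr(U_μ U_ν)`, `μ ≠ ν`). -/
theorem lap_reTr_ekWordMat_of_nodup (hN : N ≠ 0) (g : PSU (Fin d) N) {l : List (Fin d × Bool)}
    (hl : (l.map Prod.fst).Nodup) :
    Lap (fun Q : Cfg (Fin d) N => (ekWordMat l Q).trace.re) (emb g) =
      -(((N : ℝ) - 1 / N) * l.length * (ekWordMat l (emb g)).trace.re) := by
  rw [lap_reTr_ekWordMat hN g l]
  simp_rw [ekLapSum_of_nodup _ g hl, Matrix.one_mul]
  have hre : ∀ e : Fin d, (if e ∈ l.map Prod.fst then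
      -(((N : ℂ) - 1 / N) * (ekWordMat l (emb g)).trace) else 0).re =
        if e ∈ (l.map Prod.fst).toFinset then -(((N : ℝ) - 1 / N) * (ekWordMat l (emb g)).trace.re) else 0 := by
    intro e
    by_cases hm : e ∈ l.map Prod.fst
    · rw [if_pos hm, if_pos (List.mem_toFinset.2 hm)]
      have hNc : ((N : ℂ) - 1 / N) = (((N : ℝ) - 1 / N : ℝ) : ℂ) := by push_cast; ring
      rw [Complex.neg_re, hNc, Complex.re_ofReal_mul]
    · rw [if_neg hm, if_neg (fun h' => hm (List.mem_toFinset.1 h')), Complex.zero_re]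
  simp_rw [hre]
  rw [Finset.sum_ite_mem, Finset.univ_inter, Finset.sum_const, List.toFinset_card_of_nodup hl, List.length_map,
    nsmul_eq_mul]
  ring

/-! ## The loop equation of a general word at finite `N` -/

/-- **The Eguchi–Kawai loop equation for an arbitrary reduced contour at finite `N`** (Schwinger–Dyson
identity of the `SU(N)` single-site measure `w ∏ dV_μ`, `w = e^{-N² b S_R}`, every `d`, `N ≥ 1`, `b`, `l`):
`∫ w · (Σ_e Re ekLapSum e V l 1 + Γ(-N² b S_R, Re tr W_l)) = 0` — the kinetic side (Casimir terms of the
letters + SPLITTING terms of the pairs of letters on a common link, i.e. products of the two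
complementary sub-contours, open or closed: Makeenko (14.50)–(14.51)) balances the interaction side. -/
theorem ek_word_loopEquation (hN : N ≠ 0) (b : ℝ) (l : List (Fin d × Bool)) :
    ∫ V : EKConfigSU d N, Literature.Barriers.QuantumFields.ekWeight N b (inclSU V) *
        ((∑ e : Fin d, (ekLapSum e V l 1).re)
          + Gam (ekPot d N b) (fun Q : Cfg (Fin d) N => (ekWordMat l Q).trace.re) (emb V)) ∂(ekHaarSU d N) = 0 := by
  have h0 := integral_exp_mul_genL_eq_zero hN (contDiff_ekPot (d := d) (N := N) b) (contDiff_reTr_ekWordMat l)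
  simp only [genL, exp_ekPot_emb, haarPi_eq_ekHaarSU] at h0
  rw [← h0]
  refine integral_congr_ae (ae_of_all _ fun V => ?_)
  simp only [lap_reTr_ekWordMat hN V l]

end Summit.QuantumFields.YangMills.Theorems.EguchiKawaiDirectionLadder
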